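import Summits.NavierStokesRegularity.NavierStokesRegularity.Theorems.LerayQuarterDissipationFiniteDissipationLiouvilleHardness
import Summits.NavierStokesRegularity.NavierStokesRegularity.Theorems.LerayQuarterDissipationFiniteDissipationLiouvillePastDss
import Summits.NavierStokesRegularity.NavierStokesRegularity.Theorems.LerayQuarterDissipationFiniteDissipationLiouvilleStubSmallDissipationGap
import Summits.NavierStokesRegularity.NavierStokesRegularity.Theorems.LerayQuarterDissipationFiniteDissipationLiouvilleGlue
import Summits.NavierStokesRegularity.NavierStokesRegularity.Theorems.LerayQuarterDissipationRecurrentReductionD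
import HarnessLib

/-!
# `FiniteDissipationLiouville`: the crux is EXACTLY «Type-I DSS wall ∧ past-wandering Liouville»
# (structure theorem of line `birth`, v4)

Crux `Summit.NavierStokesRegularity.NavierStokesRegularity.Theses.LerayQuarterDissipation.FiniteDissipationLiouville`
(item stmt-NavierStokesRegularity-22144), route LerayQuarterDissipation, line `birth`, lead prover
ns-lqd-lead g2. NS regularity is NOT proved by anything here; no summit is.

With the children `RecurrentReductionD` (stmt-22507, `recurrentReductionD_proof`, seat ns-lqd-p1) and
the glue (stmt-22509, `finiteDissipationLiouvilleGlue_proof`) CLOSED, the small-dissipation gap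
(`stub_smallDissipationGap`, p579719), the past-DSS bridge to the wall
(`pastDssExclusion_of_typeIDSSLiouville`, p587763) and the hardness certificate
(`Hardness.typeIDSSLiouville_of_finiteDissipationLiouville`, p588754, seat ns-lqd-p1) landed, the
position of the crux is now a theorem:

* `finiteDissipationLiouville_iff_recurrentDissipativeLiouville` — FDL ⟺ its child crux
  `RecurrentDissipativeLiouville` (stmt-22508);
* `finiteDissipationLiouville_iff_wall_and_pastWandering` — FDL ⟺ (the catalogued Type-I DSS wall
  `∀ c > 1, Literature.Analysis.FluidPDE.TypeIDSSLiouville c`, Bradshaw–Tsai 2017 OP 5.1) ∧ (the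
  registered stub `stub_pastWanderingRecurrentLiouville` of the skeleton, verbatim). So the line's
  cut is lossless: the two registered open stubs are separately NECESSARY and jointly SUFFICIENT.
-/

noncomputable section

open MeasureTheory Set Function Filter
open scoped Topology ENNReal

namespace Summit.NavierStokesRegularity.NavierStokesRegularity.Theorems.FiniteDissipationLiouville.Birth

open Literature.Analysis.FluidPDE
open Summit.NavierStokesRegularity.NavierStokesRegularity.Theses.LerayQuarterDissipation

-- the problem-side namespace duplicates `NavierStokesRegularity` by design (summit = problem)
set_option linter.dupNamespace false

/-- **FDL is equivalent to its child crux `RecurrentDissipativeLiouville`** (stmt-22508): the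
restriction is trivial, the converse is the landed glue with the proved recurrent reduction
(stmt-22507). -/
theorem finiteDissipationLiouville_iff_recurrentDissipativeLiouville :
    FiniteDissipationLiouville ↔ RecurrentDissipativeLiouville :=
  ⟨fun h C K w hw hD _ => h C K w hw hD,
    fun h => finiteDissipationLiouvilleGlue_proof recurrentReductionD_proof h⟩

/-- **Structure theorem of line `birth` (v4): the crux is exactly the conjunction of its two
registered open stubs.** `FiniteDissipationLiouville` holds iff (i) the catalogued Type-I `λ`-DSS
Liouville wall `Literature.Analysis.FluidPDE.TypeIDSSLiouville c` holds for every `c > 1`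
(Bradshaw–Tsai 2017, Open Problem 5.1) AND (ii) every uniformly scaling-recurrent member of the
finite-dissipation Type-I ancient mild stratum which is not discretely self-similar on the past
for any factor `c > 1` is bounded at the apex (`stub_pastWanderingRecurrentLiouville`, verbatim).
(⇒): the wall by the hardness certificate `Hardness.typeIDSSLiouville_of_finiteDissipationLiouville`
(the envelope class lies in the stratum), the wandering clause by restriction. (⇐): the skeleton's
composition — small `K` by the gap `stub_smallDissipationGap`, otherwise the proved recurrent
reduction `recurrentReductionD_proof` and the past-DSS / past-wandering dichotomy, the DSS half by
`pastDssExclusion_of_typeIDSSLiouville`. -/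
theorem finiteDissipationLiouville_iff_wall_and_pastWandering :
    FiniteDissipationLiouville ↔
      ((∀ c : ℝ, 1 < c → TypeIDSSLiouville c) ∧
        ∀ (C K : ℝ) (w : ℝ → EuclideanSpace ℝ (Fin 3) → EuclideanSpace ℝ (Fin 3)),
          IsTypeIAncientMild C w →
          (∀ s : ℝ, s < 0 → ∫⁻ x, ‖fderiv ℝ (w s) x‖ₑ ^ 2 ≤ ENNReal.ofReal (K / Real.sqrt (-s))) →
          (∀ ε > 0, ∀ R > 1, ∃ L > 0, ∀ a : ℝ, ∃ σ ∈ Set.Icc a (a + L),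
            ∀ s ∈ Set.Icc (-(R ^ 2)) (-(R⁻¹) ^ 2),
            ∀ y ∈ Metric.closedBall (0 : EuclideanSpace ℝ (Fin 3)) R,
              ‖Real.exp σ • w (Real.exp (2 * σ) * s) (Real.exp σ • y) - w s y‖ ≤ ε) →
          (¬ ∃ c : ℝ, 1 < c ∧ ∀ t : ℝ, t < 0 → ∀ x, c • w (c ^ 2 * t) (c • x) = w t x) →
          ¬ (∀ r > 0, ∀ M : ℝ, ∃ t ∈ Set.Ioo (-(r ^ 2)) (0 : ℝ),
              ∃ x ∈ Metric.ball (0 : EuclideanSpace ℝ (Fin 3)) r, M < ‖w t x‖)) := by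
  constructor
  · intro h
    exact ⟨fun c _ => Hardness.typeIDSSLiouville_of_finiteDissipationLiouville h c,
      fun C K w hw hD _ _ => h C K w hw hD⟩
  · rintro ⟨hwall, hwand⟩ C K u hu hD hsing
    obtain ⟨K₀, -, hgap⟩ := stub_smallDissipationGap
    by_cases hK : K ≤ K₀
    · -- small dissipation: `u ≡ 0`
      have hz := hgap C K u hK hu hD
      obtain ⟨t, ht, x, -, hM⟩ := hsing 1 one_pos 0
      rw [hz t ht.2 x, norm_zero] at hM
      exact lt_irrefl _ hM
    · -- recurrent reduction, then the past-DSS / past-wandering dichotomy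
      obtain ⟨C', K', w, hw, hDw, hrec, hsw⟩ := recurrentReductionD_proof C K u hu hD hsing
      by_cases hdss : ∃ c : ℝ, 1 < c ∧ ∀ t : ℝ, t < 0 → ∀ x, c • w (c ^ 2 * t) (c • x) = w t x
      · obtain ⟨c, hc, hcw⟩ := hdss
        exact pastDssExclusion_of_typeIDSSLiouville hwall C' K' c w hc hw hDw hcw hsw
      · exact hwand C' K' w hw hDw hrec hdss hsw

/-- The same structure for the child crux: `RecurrentDissipativeLiouville` (stmt-22508) ⟺ wall ∧
past-wandering stub. -/
theorem recurrentDissipativeLiouville_iff_wall_and_pastWandering :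
    RecurrentDissipativeLiouville ↔
      ((∀ c : ℝ, 1 < c → TypeIDSSLiouville c) ∧
        ∀ (C K : ℝ) (w : ℝ → EuclideanSpace ℝ (Fin 3) → EuclideanSpace ℝ (Fin 3)),
          IsTypeIAncientMild C w →
          (∀ s : ℝ, s < 0 → ∫⁻ x, ‖fderiv ℝ (w s) x‖ₑ ^ 2 ≤ ENNReal.ofReal (K / Real.sqrt (-s))) →
          (∀ ε > 0, ∀ R > 1, ∃ L > 0, ∀ a : ℝ, ∃ σ ∈ Set.Icc a (a + L),
            ∀ s ∈ Set.Icc (-(R ^ 2)) (-(R⁻¹) ^ 2),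
            ∀ y ∈ Metric.closedBall (0 : EuclideanSpace ℝ (Fin 3)) R,
              ‖Real.exp σ • w (Real.exp (2 * σ) * s) (Real.exp σ • y) - w s y‖ ≤ ε) →
          (¬ ∃ c : ℝ, 1 < c ∧ ∀ t : ℝ, t < 0 → ∀ x, c • w (c ^ 2 * t) (c • x) = w t x) →
          ¬ (∀ r > 0, ∀ M : ℝ, ∃ t ∈ Set.Ioo (-(r ^ 2)) (0 : ℝ),
              ∃ x ∈ Metric.ball (0 : EuclideanSpace ℝ (Fin 3)) r, M < ‖w t x‖)) := by
  rw [← finiteDissipationLiouville_iff_recurrentDissipativeLiouville]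
  exact finiteDissipationLiouville_iff_wall_and_pastWandering

end Summit.NavierStokesRegularity.NavierStokesRegularity.Theorems.FiniteDissipationLiouville.Birth

end
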